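import Summits.QuantumFields.YangMills.Theorems.AllWindowsColdBoxBoxKernelShiftedDecay

/-!
# `boxLap⁻¹` against WALL-ADJACENT sites: `(1+d)⁻³` for the value, `(1+d)⁻⁴` for a gradient and for two wall-adjacent sites
# ((J′) supplement of STUB-PLAN-U1 rev 3 §7.4 — (h2)/(h3) of S3b and the sources of U1b/U1c; LINE-19/20 ⟨stmt-QuantumFields-24004⟩/⟨24336⟩, LINE-18 K1 ⟨24006⟩)

The scalar kernel package bounds `L⁻¹ = boxLap⁻¹` (`−2`), its first differences (`−3`) and mixed second differences (`−4`) between box points;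
✓`…BoxKernelShiftedDecay` (w2) adds the second-slot Dirichlet ghosts and the decay with base points one step BELOW the box.  The skin rows of the
Hodge matrix (§7.4: the inward PARALLEL neighbour of a face link enters ALONE) and the plaquette sources `λ_p` of U1b/U1c (a partner edge may be
skin or pinned) also produce SINGLE deltas at sites ADJACENT TO A DIRICHLET FACE (`t_ν ∈ {1, M−1}`, `ν ∈ Dset`); there the value is a difference
with the vanishing ghost value and gains one order.  This file packages exactly that, at the level of the matrix `boxLap⁻¹`:
* `boxGreen_grad_snd_decay_shift'`, `boxGreen_hessian_decay_shift'` — the shifted decay of ✓`…ShiftedDecay` in the interface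
  "`y = s` or `y + e_a = s`" (second slot via ✓`boxGreen_comm`);
* **`boxLap_inv_wall_decay`** `|L⁻¹(s,t)|·(1+|s_κ−t_κ|)³ ≤ C` for `t` wall-adjacent;
* **`boxLap_inv_grad_wall_decay`** `|L⁻¹(s+e_a,t) − L⁻¹(s,t)|·(1+d)⁴ ≤ C`, **`boxLap_inv_wall_grad_decay`** `|L⁻¹(t,s'+e_b) − L⁻¹(t,s')|·(1+d)⁴ ≤ C`;
* **`boxLap_inv_wall_wall_decay`** `|L⁻¹(t,t')|·(1+d)⁴ ≤ C` for `t, t'` both wall-adjacent —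
uniformly in `M ≥ 1` and the (nonempty) Dirichlet set, `d = 4`.  With ✓`boxLap_inv_grad_snd_decay` / ✓`boxLap_inv_hessian_decay` this bounds `L⁻¹φ` by
`(1+d)^{−3}` and `φᵀL⁻¹ψ` by `(1+d)^{−4}` for every admissible unit dipole `φ, ψ` (a neighbour difference, or a single delta adjacent to a Dirichlet
face) — the inputs (h2)/(h3-decay) of ✓`schur_jaffard_decay` and `a₁, a₂, a₃` of ✓`schur_jaffard_gradient_decay` / `schur_jaffard_dipole_decay`.
No definitions; standard axioms.

HONEST LABEL: helper lemmas toward the OPEN stubs S3b/U1 (⟨24004⟩, ⟨24336⟩) and K1 (⟨24006⟩); no stub, crux, rung or summit is proved here; the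
Yang–Mills mass gap is NOT proved by this file.
-/

set_option autoImplicit false

noncomputable section

open Finset ZMod
open scoped Real BigOperators

namespace Summit.QuantumFields.YangMills.Theorems.AllWindowsColdBox.BoxKernel

open Literature.Probability.LatticeModels

/-! ## The shifted decay in the "`y = s` or `y + e = s`" interface -/

/-- A base point that is a box point or one step below it: `y = s + t·e_a` with `t ∈ {0, −1}`. -/
theorem exists_eq_add_single_of_eq_or {M : ℕ} {Dset : Finset (Fin 4)} (s : Box 4 M Dset) (y : Fin 4 → ℤ) (a : Fin 4)
    (hy : y = coords s ∨ y + Pi.single a 1 = coords s) : ∃ t : ℤ, (t = 0 ∨ t = -1) ∧ y = coords s + Pi.single a t := by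
  rcases hy with rfl | hy
  · exact ⟨0, Or.inl rfl, by rw [Pi.single_zero, add_zero]⟩
  · refine ⟨-1, Or.inr rfl, ?_⟩
    rw [← hy, add_assoc, ← Pi.single_add]
    simp

/-- **Gradient decay in the source, base allowed below the box**: for box points `s, s'` and `y' = s'` or `y' + e_b = s'`,
`|G_B(s, y'+e_b) − G_B(s, y')|·(1 + |s_κ − s'_κ|)³ ≤ C` (✓`boxGreen_grad_fst_decay_shift` in the second slot via ✓`boxGreen_comm`). -/
theorem boxGreen_grad_snd_decay_shift' : ∃ C : ℝ, 0 ≤ C ∧ ∀ (M : ℕ) [NeZero M] (Dset : Finset (Fin 4)) (b κ : Fin 4) (s s' : Box 4 M Dset)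
    (y' : Fin 4 → ℤ), (y' = coords s' ∨ y' + Pi.single b 1 = coords s') →
    |boxGreen M Dset (coords s) (y' + Pi.single b 1) - boxGreen M Dset (coords s) y'| *
      (1 + |(((s.1 κ : ℕ) : ℝ)) - ((s'.1 κ : ℕ) : ℝ)|) ^ 3 ≤ C := by
  obtain ⟨C, hC0, hC⟩ := boxGreen_grad_fst_decay_shift
  refine ⟨C, hC0, ?_⟩
  intro M _ Dset b κ s s' y' hy'
  obtain ⟨t, ht, rfl⟩ := exists_eq_add_single_of_eq_or s' y' b hy'
  rw [boxGreen_comm (coords s), boxGreen_comm (coords s)]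
  have h := hC M Dset b κ t ht s' s
  rwa [abs_sub_comm (((s'.1 κ : ℕ) : ℝ)) (((s.1 κ : ℕ) : ℝ))] at h

/-- **Mixed-Hessian decay, bases allowed below the box**: for box points `s, s'`, `y = s` or `y + e_a = s`, `y' = s'` or `y' + e_b = s'`,
`|H_{ab}(y, y')|·(1 + |s_κ − s'_κ|)⁴ ≤ C`, `H_{ab}(y,y') = G_B(y+e_a,y'+e_b) − G_B(y+e_a,y') − G_B(y,y'+e_b) + G_B(y,y')` (✓`boxGreen_hessian_decay_shift`). -/
theorem boxGreen_hessian_decay_shift' : ∃ C : ℝ, 0 ≤ C ∧ ∀ (M : ℕ) [NeZero M] (Dset : Finset (Fin 4)) (a b κ : Fin 4)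
    (s s' : Box 4 M Dset) (y y' : Fin 4 → ℤ), (y = coords s ∨ y + Pi.single a 1 = coords s) → (y' = coords s' ∨ y' + Pi.single b 1 = coords s') →
    |boxGreen M Dset (y + Pi.single a 1) (y' + Pi.single b 1) - boxGreen M Dset (y + Pi.single a 1) y' -
        boxGreen M Dset y (y' + Pi.single b 1) + boxGreen M Dset y y'| *
      (1 + |(((s.1 κ : ℕ) : ℝ)) - ((s'.1 κ : ℕ) : ℝ)|) ^ 4 ≤ C := by
  obtain ⟨C, hC0, hC⟩ := boxGreen_hessian_decay_shift
  refine ⟨C, hC0, ?_⟩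
  intro M _ Dset a b κ s s' y y' hy hy'
  obtain ⟨t, ht, rfl⟩ := exists_eq_add_single_of_eq_or s y a hy
  obtain ⟨t', ht', rfl⟩ := exists_eq_add_single_of_eq_or s' y' b hy'
  exact hC M Dset a b κ t t' ht ht' s s'

/-! ## `boxLap⁻¹` against sites adjacent to a Dirichlet face -/

/-- **Wall decay**: for `t` adjacent to a Dirichlet face (`t_ν ∈ {1, M−1}`, `ν ∈ Dset`), `|L⁻¹(s,t)|·(1 + |s_κ − t_κ|)³ ≤ C` — the value is a
difference with the vanishing ghost value, hence decays like a gradient. -/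
theorem boxLap_inv_wall_decay : ∃ C : ℝ, 0 ≤ C ∧ ∀ (M : ℕ) [NeZero M] (Dset : Finset (Fin 4)), Dset.Nonempty →
    ∀ (ν κ : Fin 4), ν ∈ Dset → ∀ (s t : Box 4 M Dset), ((t.1 ν : ℕ) + 1 = M ∨ (t.1 ν : ℕ) = 1) →
    |(boxLap M Dset)⁻¹ s t| * (1 + |(((s.1 κ : ℕ) : ℝ)) - ((t.1 κ : ℕ) : ℝ)|) ^ 3 ≤ C := by
  obtain ⟨C, hC0, hC⟩ := boxGreen_grad_snd_decay_shift'
  refine ⟨C, hC0, ?_⟩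
  intro M _ Dset hD ν κ hν s t ht
  rw [boxLap_inv_eq hD]
  simp only [boxGreenMat, Matrix.of_apply]
  rcases ht with ht | ht
  · -- top: `G(s,t) = −(G(s,t+e_ν) − G(s,t))`
    have h0 := boxGreen_dirichlet_top_snd hν t ht (coords s)
    have h := hC M Dset ν κ s t (coords t) (Or.inl rfl)
    rw [h0, zero_sub, abs_neg] at h
    exact h
  · -- bottom: `G(s,t) = G(s,(t−e_ν)+e_ν) − G(s,t−e_ν)`
    have h0 := boxGreen_dirichlet_bottom_snd hν t ht (coords s)
    have h := hC M Dset ν κ s t (coords t - Pi.single ν 1) (Or.inr (sub_add_cancel _ _))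
    rw [h0, sub_zero, sub_add_cancel] at h
    exact h

/-- **Gradient against a wall-adjacent site**: for box points `s, u = s + e_a` and `t` adjacent to a Dirichlet face in direction `ν ∈ Dset`,
`|L⁻¹(u,t) − L⁻¹(s,t)|·(1 + |s_κ − t_κ|)⁴ ≤ C` (a mixed Hessian with one ghost difference). -/
theorem boxLap_inv_grad_wall_decay : ∃ C : ℝ, 0 ≤ C ∧ ∀ (M : ℕ) [NeZero M] (Dset : Finset (Fin 4)), Dset.Nonempty →
    ∀ (a ν κ : Fin 4), ν ∈ Dset → ∀ (s u t : Box 4 M Dset), coords u = coords s + Pi.single a 1 →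
    ((t.1 ν : ℕ) + 1 = M ∨ (t.1 ν : ℕ) = 1) →
    |(boxLap M Dset)⁻¹ u t - (boxLap M Dset)⁻¹ s t| * (1 + |(((s.1 κ : ℕ) : ℝ)) - ((t.1 κ : ℕ) : ℝ)|) ^ 4 ≤ C := by
  obtain ⟨C, hC0, hC⟩ := boxGreen_hessian_decay_shift'
  refine ⟨C, hC0, ?_⟩
  intro M _ Dset hD a ν κ hν s u t hu ht
  rw [boxLap_inv_eq hD]
  simp only [boxGreenMat, Matrix.of_apply, hu]
  rcases ht with ht | ht
  · have h1 := boxGreen_dirichlet_top_snd hν t ht (coords s + Pi.single a 1)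
    have h2 := boxGreen_dirichlet_top_snd hν t ht (coords s)
    have h := hC M Dset a ν κ s t (coords s) (coords t) (Or.inl rfl) (Or.inl rfl)
    rw [h1, h2, zero_sub, sub_zero, neg_add_eq_sub, abs_sub_comm] at h
    exact h
  · have h1 := boxGreen_dirichlet_bottom_snd hν t ht (coords s + Pi.single a 1)
    have h2 := boxGreen_dirichlet_bottom_snd hν t ht (coords s)
    have h := hC M Dset a ν κ s t (coords s) (coords t - Pi.single ν 1) (Or.inl rfl) (Or.inr (sub_add_cancel _ _))
    rw [h1, h2, sub_zero, add_zero, sub_add_cancel] at h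
    exact h

/-- **Wall-adjacent site against a gradient**: for `t` adjacent to a Dirichlet face in direction `ν ∈ Dset` and box points `s', u' = s' + e_b`,
`|L⁻¹(t,u') − L⁻¹(t,s')|·(1 + |t_κ − s'_κ|)⁴ ≤ C`. -/
theorem boxLap_inv_wall_grad_decay : ∃ C : ℝ, 0 ≤ C ∧ ∀ (M : ℕ) [NeZero M] (Dset : Finset (Fin 4)), Dset.Nonempty →
    ∀ (ν b κ : Fin 4), ν ∈ Dset → ∀ (t s' u' : Box 4 M Dset), ((t.1 ν : ℕ) + 1 = M ∨ (t.1 ν : ℕ) = 1) →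
    coords u' = coords s' + Pi.single b 1 →
    |(boxLap M Dset)⁻¹ t u' - (boxLap M Dset)⁻¹ t s'| * (1 + |(((t.1 κ : ℕ) : ℝ)) - ((s'.1 κ : ℕ) : ℝ)|) ^ 4 ≤ C := by
  obtain ⟨C, hC0, hC⟩ := boxGreen_hessian_decay_shift'
  refine ⟨C, hC0, ?_⟩
  intro M _ Dset hD ν b κ hν t s' u' ht hu'
  rw [boxLap_inv_eq hD]
  simp only [boxGreenMat, Matrix.of_apply, hu']
  rcases ht with ht | ht
  · have h1 := boxGreen_dirichlet_top hν t ht (coords s' + Pi.single b 1)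
    have h2 := boxGreen_dirichlet_top hν t ht (coords s')
    have h := hC M Dset ν b κ t s' (coords t) (coords s') (Or.inl rfl) (Or.inl rfl)
    rw [h1, h2, sub_zero, zero_sub, neg_add_eq_sub, abs_sub_comm] at h
    exact h
  · have h1 := boxGreen_dirichlet_bottom hν t ht (coords s' + Pi.single b 1)
    have h2 := boxGreen_dirichlet_bottom hν t ht (coords s')
    have h := hC M Dset ν b κ t s' (coords t - Pi.single ν 1) (coords s') (Or.inr (sub_add_cancel _ _)) (Or.inl rfl)
    rw [h1, h2, sub_zero, add_zero, sub_add_cancel] at h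
    exact h

/-- **Two wall-adjacent sites**: for `t` adjacent to a Dirichlet face in direction `ν ∈ Dset` and `t'` adjacent to one in direction `ν' ∈ Dset`,
`|L⁻¹(t,t')|·(1 + |t_κ − t'_κ|)⁴ ≤ C` (a mixed Hessian with two ghost differences). -/
theorem boxLap_inv_wall_wall_decay : ∃ C : ℝ, 0 ≤ C ∧ ∀ (M : ℕ) [NeZero M] (Dset : Finset (Fin 4)), Dset.Nonempty →
    ∀ (ν ν' κ : Fin 4), ν ∈ Dset → ν' ∈ Dset → ∀ (t t' : Box 4 M Dset), ((t.1 ν : ℕ) + 1 = M ∨ (t.1 ν : ℕ) = 1) →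
    ((t'.1 ν' : ℕ) + 1 = M ∨ (t'.1 ν' : ℕ) = 1) →
    |(boxLap M Dset)⁻¹ t t'| * (1 + |(((t.1 κ : ℕ) : ℝ)) - ((t'.1 κ : ℕ) : ℝ)|) ^ 4 ≤ C := by
  obtain ⟨C, hC0, hC⟩ := boxGreen_hessian_decay_shift'
  refine ⟨C, hC0, ?_⟩
  intro M _ Dset hD ν ν' κ hν hν' t t' ht ht'
  rw [boxLap_inv_eq hD]
  simp only [boxGreenMat, Matrix.of_apply]
  rcases ht with ht | ht <;> rcases ht' with ht' | ht'
  · -- top / top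
    have h1 := boxGreen_dirichlet_top hν t ht (coords t' + Pi.single ν' 1)
    have h2 := boxGreen_dirichlet_top hν t ht (coords t')
    have h3 := boxGreen_dirichlet_top_snd hν' t' ht' (coords t)
    have h := hC M Dset ν ν' κ t t' (coords t) (coords t') (Or.inl rfl) (Or.inl rfl)
    rw [h1, h2, h3, sub_zero, sub_zero, zero_add] at h
    exact h
  · -- top / bottom
    have h1 := boxGreen_dirichlet_top hν t ht (coords t' - Pi.single ν' 1 + Pi.single ν' 1)
    have h2 := boxGreen_dirichlet_top hν t ht (coords t' - Pi.single ν' 1)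
    have h3 := boxGreen_dirichlet_bottom_snd hν' t' ht' (coords t)
    have h := hC M Dset ν ν' κ t t' (coords t) (coords t' - Pi.single ν' 1) (Or.inl rfl) (Or.inr (sub_add_cancel _ _))
    rw [h1, h2, h3, sub_zero, zero_sub, add_zero, abs_neg, sub_add_cancel] at h
    exact h
  · -- bottom / top
    have h1 := boxGreen_dirichlet_bottom hν t ht (coords t' + Pi.single ν' 1)
    have h2 := boxGreen_dirichlet_bottom hν t ht (coords t')
    have h3 := boxGreen_dirichlet_top_snd hν' t' ht' (coords t - Pi.single ν 1 + Pi.single ν 1)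
    have h := hC M Dset ν ν' κ t t' (coords t - Pi.single ν 1) (coords t') (Or.inr (sub_add_cancel _ _)) (Or.inl rfl)
    rw [h1, h2, h3, zero_sub, sub_zero, add_zero, abs_neg, sub_add_cancel] at h
    exact h
  · -- bottom / bottom
    have h1 := boxGreen_dirichlet_bottom hν t ht (coords t' - Pi.single ν' 1 + Pi.single ν' 1)
    have h2 := boxGreen_dirichlet_bottom hν t ht (coords t' - Pi.single ν' 1)
    have h3 := boxGreen_dirichlet_bottom_snd hν' t' ht' (coords t - Pi.single ν 1 + Pi.single ν 1)
    have h := hC M Dset ν ν' κ t t' (coords t - Pi.single ν 1) (coords t' - Pi.single ν' 1) (Or.inr (sub_add_cancel _ _))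
      (Or.inr (sub_add_cancel _ _))
    rw [h1, h2, h3, sub_zero, sub_zero, add_zero, sub_add_cancel, sub_add_cancel] at h
    exact h

end Summit.QuantumFields.YangMills.Theorems.AllWindowsColdBox.BoxKernel

end
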